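import Literature.NumberTheory.Congruences.JacobsthalBlockPolynomial
import Mathlib.NumberTheory.Padics.PadicVal.Basic
import Mathlib.Data.Nat.Factorization.Basic
import Mathlib.Data.Nat.Choose.Basic
import Mathlib.Tactic
import HarnessLib

/-!
# Jacobsthal's binomial congruence: `C(ap, bp) ≡ C(a, b) (mod p^{3 + v_p(a) + v_p(b) + v_p(a−b)})`, `p ≥ 5`

Topic `Literature/NumberTheory/Congruences`, namespace `Literature.NumberTheory.Congruences.Jacobsthal`;
the last of the three files `JacobsthalBlockCongruence` → `JacobsthalBlockPolynomial` → this one (the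
first holds the sources VERBATIM — [Mestrovic2011] §6 (34)–(36) with Remarks 15–17, [Straub2014]
Lemma 5.1 — and the route). Everything here is PROVED (theorems only; no definitions, no named facts).
HONEST FRAMING (cell pub-zeta5, D2 lens): a classical `p`-adic congruence for binomial coefficients
(Jacobsthal 1952, Kazandzidis 1968); nothing about `ζ(5)` or any irrationality statement. Downstream use:
Straub's Lemma 5.3 / Theorem 1.2 (the prime-power supercongruences `A(p^r 𝐧) ≡ A(p^{r−1} 𝐧) (mod p^{3r})`
for the Apéry numbers, named facts `MultivariateAperyNumbers.theorem12`, `coster1988_supercongruence`,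
`example34_supercongruence` of the tree) needs exactly the ratio form below.

## Main statements (`p` prime, `3 < p`; `v_p = padicValNat p`, so `v_p(0) = 0` — the degenerate cases are trivial)

* `factorial_mul_prime` — `(mp)! = p^m · m! · ∏_{k<m} ∏_{0<j<p} (kp + j)`;
  `choose_mul_prime_mul_prod` — the exact identity
  `C((b+c)p, bp) · ∏_{k<c}∏_j (kp + j) = C(b+c, b) · ∏_{k<c}∏_j (bp + kp + j)`.
* **`exists_ratio`** — the RATIO FORM: there are `x, y ∈ ℕ` with `p ∤ y`, `y · C(ap, bp) = x · C(a, b)`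
  and `x ≡ y (mod p^{3 + v_p(a) + v_p(b) + v_p(a−b)})` («`C(ap, bp)/C(a, b) ≡ 1 (mod p^q)`, `q` the
  power of `p` dividing `p³ab(a−b)`», [Straub2014] (41) for `p ≥ 5`, `a, b ≥ 0`).
* **`pow_dvd_choose_mul_prime_sub_choose`** — `p^{3 + v_p(a) + v_p(b) + v_p(a−b) + v_p(C(a,b))} ∣
  C(ap, bp) − C(a, b)` (the sharp form of [Mestrovic2011] Remark 17), and
  **`choose_mul_prime_modEq`** — (34) as printed: `C(ap, bp) ≡ C(a, b) (mod p^{3+v_p(a)+v_p(b)+v_p(a−b)})`.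
* `choose_mul_prime_pow_modEq` — (36): `C(np^r, mp^r) ≡ C(np^{r−1}, mp^{r−1}) (mod p^{3r})`, `r ≥ 1`.

Desk check (this seat, exact arithmetic): `v_p(C(ap,bp)/C(a,b) − 1) = 3 + v_p(a) + v_p(b) + v_p(a−b)`
EXACTLY for all `0 < b < a < 60`, `p ∈ {5, 7, 11, 13}` (6,844 cases; none of these `p` divides `B_{p−3}`).

References: [Mestrovic2011] §6 (34)–(36), Remarks 15–17; [Straub2014] Lemma 5.1; [HardyWright2008]
Thms 126, 128 (via the tree). The factorial identity is adapted from the tree's `Ljunggren` file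
(private there).
-/

noncomputable section

open Polynomial Finset
open scoped Nat

namespace Literature.NumberTheory.Congruences.Jacobsthal

section Binomial

variable {p : ℕ} [hp : Fact p.Prime]

omit hp in
/-- `(N + 1)(N + 2)⋯(N + m)` as a product over `Icc 1 m`. [folklore] -/
private theorem ascFactorial_succ_eq_prod (N m : ℕ) :
    (N + 1).ascFactorial m = ∏ i ∈ Icc 1 m, (N + i) := by
  -- adapted from the tree's `Ljunggren` file (private there)
  induction m with
  | zero => simp
  | succ m ih => rw [Nat.ascFactorial_succ, ih, Finset.prod_Icc_succ_top (by omega)]; ring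

/-- `(mp)! = p^m · m! · ∏_{k<m} (kp + 1)(kp + 2)⋯(kp + p − 1)` (the multiples of `p` up to `mp` contribute
`p^m m!`). [folklore] -/
private theorem factorial_mul_prime (m : ℕ) :
    (m * p)! = p ^ m * m ! * ∏ k ∈ range m, ∏ i ∈ Icc 1 (p - 1), (k * p + i) := by
  -- adapted from the tree's `Ljunggren.factorial_mul_prime` (private there)
  have hp1 : 1 ≤ p := hp.out.one_lt.le
  induction m with
  | zero => simp
  | succ n ih =>
    have hblock : (n * p)! * ((∏ i ∈ Icc 1 (p - 1), (n * p + i)) * (n * p + p)) = ((n + 1) * p)! := by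
      have h := Nat.factorial_mul_ascFactorial (n * p) p
      rw [show n * p + p = (n + 1) * p by ring] at h
      rw [← h]
      congr 1
      obtain ⟨k, rfl⟩ : ∃ k, p = k + 1 := ⟨p - 1, by omega⟩
      simp only [Nat.add_sub_cancel]
      rw [ascFactorial_succ_eq_prod, Finset.prod_Icc_succ_top (by omega)]
    rw [← hblock, ih, Finset.prod_range_succ, Nat.factorial_succ, pow_succ]
    ring

omit hp in
/-- The prime-to-`p` part of `((b + c)p)!` splits as that of `(bp)!` times the block product shifted by
`bp`: `∏_{k<b+c} ∏_i (kp + i) = ∏_{k<b} ∏_i (kp + i) · ∏_{k<c} ∏_i (bp + (kp + i))`. [folklore] -/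
private theorem prod_blocks_add (b c : ℕ) :
    ∏ k ∈ range (b + c), ∏ i ∈ Icc 1 (p - 1), (k * p + i) =
      (∏ k ∈ range b, ∏ i ∈ Icc 1 (p - 1), (k * p + i)) *
        ∏ k ∈ range c, ∏ i ∈ Icc 1 (p - 1), (b * p + (k * p + i)) := by
  rw [prod_range_add]
  congr 1
  refine prod_congr rfl fun k _ => prod_congr rfl fun i _ => ?_
  ring

/-- A block product contains no multiple of `p`. [folklore] -/
private theorem not_dvd_prod_blocks (c : ℕ) : ¬ p ∣ ∏ k ∈ range c, ∏ i ∈ Icc 1 (p - 1), (k * p + i) := by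
  have hp' := hp.out
  intro h
  obtain ⟨k, -, hk⟩ := (Prime.dvd_finsetProd_iff hp'.prime _).mp h
  obtain ⟨i, hi, hki⟩ := (Prime.dvd_finsetProd_iff hp'.prime _).mp hk
  have hi' := mem_Icc.mp hi
  have : p ∣ i := (Nat.dvd_add_right (dvd_mul_left p k)).mp hki
  have := Nat.le_of_dvd (by omega) this
  omega

/-- **The exact identity behind Jacobsthal's congruence**: for `a = b + c`,
`C(ap, bp) · ∏_{0<i<cp, p∤i} i = C(a, b) · ∏_{0<i<cp, p∤i} (bp + i)`. [folklore] -/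
private theorem choose_mul_prime_mul_prod (b c : ℕ) :
    ((b + c) * p).choose (b * p) * ∏ k ∈ range c, ∏ i ∈ Icc 1 (p - 1), (k * p + i) =
      (b + c).choose b * ∏ k ∈ range c, ∏ i ∈ Icc 1 (p - 1), (b * p + (k * p + i)) := by
  have hp' := hp.out
  set Qb := ∏ k ∈ range b, ∏ i ∈ Icc 1 (p - 1), (k * p + i) with hQb
  set Qc := ∏ k ∈ range c, ∏ i ∈ Icc 1 (p - 1), (k * p + i) with hQc
  set R := ∏ k ∈ range c, ∏ i ∈ Icc 1 (p - 1), (b * p + (k * p + i)) with hR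
  have h1 := Nat.choose_mul_factorial_mul_factorial (show b * p ≤ (b + c) * p by nlinarith)
  rw [show (b + c) * p - b * p = c * p by rw [Nat.add_mul, Nat.add_sub_cancel_left],
    factorial_mul_prime (p := p) (b + c), factorial_mul_prime (p := p) b, factorial_mul_prime (p := p) c,
    prod_blocks_add, ← hQb, ← hQc, ← hR] at h1
  have h2 := Nat.choose_mul_factorial_mul_factorial (Nat.le_add_right b c)
  rw [Nat.add_sub_cancel_left] at h2
  have hD : 0 < p ^ (b + c) * b ! * c ! * Qb := by
    have hQ : 0 < Qb := Nat.pos_of_ne_zero fun h =>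
      not_dvd_prod_blocks (p := p) b (by rw [← hQb, h]; exact dvd_zero p)
    exact Nat.mul_pos (Nat.mul_pos (Nat.mul_pos (pow_pos hp'.pos _) (Nat.factorial_pos b))
      (Nat.factorial_pos c)) hQ
  refine Nat.eq_of_mul_eq_mul_right hD ?_
  calc ((b + c) * p).choose (b * p) * Qc * (p ^ (b + c) * b ! * c ! * Qb)
      = ((b + c) * p).choose (b * p) * (p ^ b * b ! * Qb) * (p ^ c * c ! * Qc) := by rw [pow_add]; ring
    _ = p ^ (b + c) * (b + c)! * (Qb * R) := h1
    _ = p ^ (b + c) * ((b + c).choose b * b ! * c !) * (Qb * R) := by rw [h2]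
    _ = (b + c).choose b * R * (p ^ (b + c) * b ! * c ! * Qb) := by ring

/-- **Jacobsthal's congruence, unit-ratio form.** For a prime `p ≥ 5` and all `a, b`: there are natural
numbers `x, y` with `p ∤ y`, `y · C(ap, bp) = x · C(a, b)` and `x ≡ y (mod p^{3 + v_p(a) + v_p(b) + v_p(a−b)})`
— i.e. «`C(ap, bp) / C(a, b) ≡ 1 (mod p^q)`, where `q` is the power of `p` dividing `p³ab(a−b)`»
(here `x = ∏_{0<i<(a−b)p, p∤i} (bp + i)`, `y = ∏_{0<i<(a−b)p, p∤i} i`; for `b > a` both binomial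
coefficients vanish). Stated with Mathlib's `padicValNat` (so `v_p(0) = 0`; the cases `b = 0`, `b = a`
are trivial). [cite: Mestrovic2011, §6 (34)] [cite: Straub2014, Lemma 5.1 (41)] -/
theorem exists_ratio (h3 : 3 < p) (a b : ℕ) :
    ∃ x y : ℕ, ¬ p ∣ y ∧ y * (a * p).choose (b * p) = x * a.choose b ∧
      x ≡ y [MOD p ^ (3 + padicValNat p a + padicValNat p b + padicValNat p (a - b))] := by
  have hp' := hp.out
  rcases Nat.lt_or_ge a b with hab | hab
  · refine ⟨1, 1, fun h => hp'.one_lt.ne' (Nat.eq_one_of_dvd_one h), ?_, Nat.ModEq.refl 1⟩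
    rw [Nat.choose_eq_zero_of_lt hab, Nat.choose_eq_zero_of_lt ((Nat.mul_lt_mul_right hp'.pos).mpr hab)]
  obtain ⟨c, rfl⟩ := Nat.exists_eq_add_of_le hab
  rw [Nat.add_sub_cancel_left]
  refine ⟨∏ k ∈ range c, ∏ i ∈ Icc 1 (p - 1), (b * p + (k * p + i)),
    ∏ k ∈ range c, ∏ i ∈ Icc 1 (p - 1), (k * p + i), not_dvd_prod_blocks (p := p) c, ?_, ?_⟩
  · rw [mul_comm, choose_mul_prime_mul_prod (p := p) b c, mul_comm]
  -- evaluate the block polynomial congruence at `x = b`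
  obtain ⟨H, hH⟩ := exists_blocks_eq (p := p) h3 c
  have hev := congrArg (fun P : ℤ[X] => P.eval (b : ℤ)) hH
  simp only [eval_prod, eval_add, eval_mul, eval_C, eval_X] at hev
  rw [Nat.modEq_iff_dvd]
  have hx : ((∏ k ∈ range c, ∏ i ∈ Icc 1 (p - 1), (b * p + (k * p + i)) : ℕ) : ℤ) =
      ∏ k ∈ range c, ∏ i ∈ Icc 1 (p - 1), ((p : ℤ) * b + ((k * p + i : ℕ) : ℤ)) := by
    push_cast
    exact prod_congr rfl fun k _ => prod_congr rfl fun i _ => by ring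
  rw [hx, hev]
  push_cast
  rw [show (∏ k ∈ range c, ∏ i ∈ Icc 1 (p - 1), ((k : ℤ) * p + i)) -
      ((∏ k ∈ range c, ∏ i ∈ Icc 1 (p - 1), ((k : ℤ) * p + i)) +
        (p : ℤ) ^ (padicValNat p c + 3) * b * (b + c) * H.eval (b : ℤ)) =
      -((p : ℤ) ^ (padicValNat p c + 3) * b * ((b + c) * H.eval (b : ℤ))) by ring, dvd_neg]
  rw [show 3 + padicValNat p (b + c) + padicValNat p b + padicValNat p c =
      (padicValNat p c + 3) + padicValNat p b + padicValNat p (b + c) by ring, pow_add, pow_add]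
  have hb : (p : ℤ) ^ padicValNat p b ∣ (b : ℤ) := by
    exact_mod_cast (pow_padicValNat_dvd (p := p) (n := b))
  have hbc : (p : ℤ) ^ padicValNat p (b + c) ∣ ((b : ℤ) + c) := by
    exact_mod_cast (pow_padicValNat_dvd (p := p) (n := b + c))
  exact mul_dvd_mul (mul_dvd_mul_left _ hb) (hbc.mul_right _)

/-- **Jacobsthal's congruence (Jacobsthal 1952 / Kazandzidis 1968), divisibility form.** For a prime
`p ≥ 5` and all natural numbers `a, b`:
`p^{3 + v_p(a) + v_p(b) + v_p(a−b) + v_p(C(a,b))} ∣ C(ap, bp) − C(a, b)` — the printed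
«`C(np, mp) ≡ C(n, m) (mod p^t)`, where `t` is the power of `p` dividing `p³nm(n−m)`», in the sharper
form with the extra factor `C(n, m)` (Helou–Terjanian / the `p`-adic ratio form, Meštrović Remark 17).
PROOF ROUTE (these files; not the printed `p`-adic one): Bauer's identical congruence and the
Leudesdorf theorem give `∏_{p∤i<cp} (px + i) ≡ ∏ i (mod p^{3+v_p(c)} ℤ[x])`; the reflection `i ↦ cp − i`
makes `x = −c` a second root besides `x = 0`; evaluate at `x = b`, `c = a − b`.
[cite: Mestrovic2011, §6 (34) and Remark 17] [cite: Straub2014, Lemma 5.1 (41)] -/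
theorem pow_dvd_choose_mul_prime_sub_choose (h3 : 3 < p) (a b : ℕ) :
    (p : ℤ) ^ (3 + padicValNat p a + padicValNat p b + padicValNat p (a - b) + padicValNat p (a.choose b)) ∣
      ((a * p).choose (b * p) : ℤ) - a.choose b := by
  have hp' := hp.out
  obtain ⟨x, y, hy, hxy, hmod⟩ := exists_ratio (p := p) h3 a b
  set N := 3 + padicValNat p a + padicValNat p b + padicValNat p (a - b) with hN
  -- `y (C(ap,bp) − C(a,b)) = (x − y) C(a,b)`
  have hid : (y : ℤ) * (((a * p).choose (b * p) : ℤ) - a.choose b) = ((x : ℤ) - y) * a.choose b := by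
    have := congrArg (Nat.cast : ℕ → ℤ) hxy
    push_cast at this
    linear_combination this
  have h1 : (p : ℤ) ^ N ∣ (x : ℤ) - y := by
    have := (Nat.modEq_iff_dvd.mp hmod.symm)
    simpa using this
  have h2 : (p : ℤ) ^ padicValNat p (a.choose b) ∣ (a.choose b : ℤ) := by
    exact_mod_cast (pow_padicValNat_dvd (p := p) (n := a.choose b))
  have h12 : (p : ℤ) ^ (N + padicValNat p (a.choose b)) ∣ (y : ℤ) * (((a * p).choose (b * p) : ℤ) - a.choose b) := by
    rw [hid, pow_add]
    exact mul_dvd_mul h1 h2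
  have hcop : IsCoprime ((p : ℤ) ^ (N + padicValNat p (a.choose b))) (y : ℤ) := by
    have h : Nat.Coprime (p ^ (N + padicValNat p (a.choose b))) y :=
      Nat.Coprime.pow_left _ ((Nat.Prime.coprime_iff_not_dvd hp').mpr hy)
    have := Nat.isCoprime_iff_coprime.mpr h
    push_cast at this
    exact this
  exact hcop.dvd_of_dvd_mul_left h12

/-- **Jacobsthal's congruence** as printed: for a prime `p ≥ 5` and all `a, b`,
`C(ap, bp) ≡ C(a, b) (mod p^{3 + v_p(a) + v_p(b) + v_p(a−b)})`. [cite: Mestrovic2011, §6 (34)] -/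
theorem choose_mul_prime_modEq (h3 : 3 < p) (a b : ℕ) :
    (a * p).choose (b * p) ≡ a.choose b [MOD p ^ (3 + padicValNat p a + padicValNat p b + padicValNat p (a - b))] := by
  refine (Nat.modEq_iff_dvd.mpr ?_).symm
  have h := pow_dvd_choose_mul_prime_sub_choose (p := p) h3 a b
  rw [pow_add] at h
  push_cast
  exact (dvd_mul_right _ _).trans h

/-- **Prime powers** (Meštrović (36); the form used for the Apéry-number supercongruences): for a prime
`p ≥ 5`, `r ≥ 1` and all `n, m`, `C(np^r, mp^r) ≡ C(np^{r−1}, mp^{r−1}) (mod p^{3r})`.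
[cite: Mestrovic2011, §6 (36)] -/
theorem choose_mul_prime_pow_modEq (h3 : 3 < p) {r : ℕ} (hr : 1 ≤ r) (n m : ℕ) :
    (n * p ^ r).choose (m * p ^ r) ≡ (n * p ^ (r - 1)).choose (m * p ^ (r - 1)) [MOD p ^ (3 * r)] := by
  have hp' := hp.out
  obtain ⟨r, rfl⟩ : ∃ r', r = r' + 1 := ⟨r - 1, by omega⟩
  rw [Nat.add_sub_cancel, pow_succ, ← mul_assoc, ← mul_assoc]
  -- trivial cases
  rcases Nat.eq_zero_or_pos m with hm | hm
  · subst hm; simp [Nat.ModEq.refl]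
  rcases Nat.lt_or_ge m n with hmn | hmn
  swap
  · rcases hmn.eq_or_lt with h | h
    · subst h; simp [Nat.ModEq.refl]
    · have hpr : 0 < p ^ r := pow_pos hp'.pos r
      have h1 : n * p ^ r < m * p ^ r := (Nat.mul_lt_mul_right hpr).mpr h
      have h2 : n * p ^ r * p < m * p ^ r * p := (Nat.mul_lt_mul_right hp'.pos).mpr h1
      rw [Nat.choose_eq_zero_of_lt h2, Nat.choose_eq_zero_of_lt h1]
  have hn : 0 < n := by omega
  have key := choose_mul_prime_modEq (p := p) h3 (n * p ^ r) (m * p ^ r)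
  refine Nat.ModEq.of_dvd (pow_dvd_pow p ?_) key
  have hpr : p ^ r ≠ 0 := pow_ne_zero _ hp'.ne_zero
  rw [← Nat.sub_mul, padicValNat.mul hn.ne' hpr, padicValNat.mul hm.ne' hpr,
    padicValNat.mul (by omega) hpr, padicValNat.prime_pow]
  omega

end Binomial

end Literature.NumberTheory.Congruences.Jacobsthal

end
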